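import Summits.HubbardSuperconductivity.HubbardSuperconductivity.Theses.AposterioriCapRg

/-!
# Successor sketch for crux `CapRgSymmetricCertificatePinned` (stmt-HubbardSuperconductivity-14045) — lead c6

Companion of `VERDICT-c6.md` (verdict: MISSTATED AS FILED).  This file is EVIDENCE for the route-repair
planner, not a line and not a statement item (D-0014: the lead may not restate the crux).  It types, against
the current tree (route rev 34), the minimal successor shape that the eleven seats on this item converge on
(STRATEGY-CENSUS.md §7 (a)(c)(d)(h), REFUTE-c3.md §5, rattack-14045 `Repair.lean` C′), and checks that the
route glue survives it by pure logic:

* §1 `capRgDataSized E₁ hE` — the literal record `π₀ = capRgCornerDataT` with the ONE size numeral every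
  computation finds infeasible (`E₁ = quarticBound = 4`) turned into a parameter, ranging over the explicit
  compact family `sizeFamily = [4, 8] ∩ ℚ` (census §7(a)(b): `‖𝒱₄‖_∞ ≈ 5.9–6.1` at the corner where
  `λ_d ≥ 1/8`; regime numerals — window `[1/8,1/5]`, Stoner margin, Cooper margin, scale range, `d_vH` —
  stay literal).
* §2 `CapRgSymmetricCertificateSized` — [2′]: `∃ E₁ ∈ 𝒮, ∃ (U, δ, μ), density(U, μ) → 1 − δ ∧ ∀ Θ ∃ (K, Λ, L₀),
  symmetricRegimeCertificateT U (μ - U/2) (capRgDataSized E₁) Θ K Λ L₀` — the certificate read at the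
  GRASSMANN chemical potential `μ - U/2` (rattack-14045 C′: with the tree's symmetric Matsubara set
  `n ∈ [-M, M)` and `V = U∫ψ⁺↑ψ⁻↑ψ⁺↓ψ⁻↓`, every tadpole of the `M → ∞` limit is `⟨n_{kσ}⟩ - ½`, so the
  Grassmann action at `μ_G` is the operator model `hubbardTorusWith 2 L 1 U (μ_G + U/2)`; as filed, [2]
  certifies the filling `n_op(μ + U/2)`, not `1 - δ`).
* §3 `SeededBrokenRegimeBoseFermiSized` — [3′]: the consumer re-typed in the same pass (`∀ E₁ ∈ 𝒮`, same
  shifted certificate), and `fixedPoint_of_sized : [2′] → [3′] → R → FixedPointDWaveOrder` (pure logic, the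
  `closes` step 1 verbatim with one more `obtain`).  R = `AposterioriOrderCriterionR` is used AS FILED; the
  planner should decide whether R's report `hubbardScaleReportCT U μ D h` needs the same `μ - U/2` reading
  (it is the place where the Grassmann/operator bridge is consumed).
* §4 the census's decomposition Dc1 re-typed over the sized record: `DensityLocalisedOn` (operator side,
  its own item; census §7(d)) and `CertificateOnIntervalSized` (Grassmann side) with
  `sized_of_subs : U ∈ [2,3] → Sub_D → Sub_C → [2′]`.

NOT typed here (cannot be, over the tree's vocabulary; census §5 Dc2 / §7(g)): the ENGINE `Sub_E` — a
record-free sectorised single-scale remainder bound for the Wick-ordered Hubbard flow at `U ∈ [9/4, 3]`,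
uniform in `(L, β, M)` — which every line of [2] AND of [2′] needs and no printed theorem supplies
(constructive radii `|U| ≲ 10⁻²`; sign-blind radius `U_c(Λ*) ≤ 1.8 < 2`).  The verdict file recommends filing
it as ONE conjecture-grade crux with a barrier entry rather than re-seating leads on [2]/[2′].

`lean check`: rc 0, 0 sorry (this seat).
-/

noncomputable section

set_option linter.dupNamespace false

namespace Summit.HubbardSuperconductivity.HubbardSuperconductivity.Cruxes.CapRgSymmetricCertificatePinned.SuccessorC6

open Literature.MathematicalPhysics.QuantumLattice Literature.Probability.LatticeModels Filter
open Summit.HubbardSuperconductivity.HubbardSuperconductivity.Theses.AposterioriCapRg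

/-! ## §1 The sized record family -/

/-- The size family `𝒮` for the quartic bound `E₁`: the rationals of `[4, 8]` (census §7(b): a single sup
norm carrying the window at `a = 1/8` must be `≥ 6–8`; `4` is the filed value, kept as the lower end). -/
def sizeFamily : Set ℚ := Set.Icc 4 8

/-- Members of the size family are positive. -/
theorem sizeFamily_pos {E₁ : ℚ} (h : E₁ ∈ sizeFamily) : 0 < E₁ :=
  lt_of_lt_of_le (by norm_num) h.1

/-- `π₀(E₁)`: the literal corner record `capRgCornerDataT` with the quartic bound replaced by the parameter
`E₁ > 0` (every other field — frame budget `10` at decay `4`, `E₃ = 32` at `h_r = 1/4` on degrees `≤ 10`,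
`c₁ = 1/2`, `σ = 1/4`, `ζ = 1/2`, shell geometry, scale range `[1/100, 3/10]` — byte-identical). -/
def capRgDataSized (E₁ : ℚ) (hE : 0 < E₁) : SymmetricRegimeDataT :=
  { capRgCornerDataT with quarticBound := E₁, quarticBound_pos := hE }

/-- The sized record has quartic bound `E₁`. -/
@[simp] theorem capRgDataSized_quarticBound (E₁ : ℚ) (hE : 0 < E₁) :
    (capRgDataSized E₁ hE).quarticBound = E₁ := rfl

/-- At `E₁ = 4` the sized record IS the filed record `π₀`. -/
theorem capRgDataSized_four : capRgDataSized 4 (by norm_num) = capRgCornerDataT := by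
  rfl

/-- The grand-canonical tracial ground-state density of the OPERATOR model along `L + 1` (the density
clause of `FixedPointDWaveOrder`, byte-identical integrand). -/
def gcDensitySeq (U μ : ℝ) (L : ℕ) : ℝ :=
  ((hubbardTorusWith 2 (L + 1) 1 U μ).groundStateFunctional totalNumber).re / ((L + 1 : ℕ) : ℝ) ^ 2

/-! ## §2 The successor producer [2′] -/

/-- **[2′] `CapRgSymmetricCertificateSized`** (sketch): sizes `∃`-bound over `𝒮`, certificate read at the
Grassmann chemical potential `μ - U/2`, density clause unchanged (operator `μ`). -/
def CapRgSymmetricCertificateSized : Prop :=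
  ∃ E₁ : ℚ, ∃ hE : E₁ ∈ sizeFamily, ∃ U ∈ Set.Icc (2:ℝ) 3, ∃ δ ∈ Set.Icc (1/5:ℝ) (7/20), ∃ μ : ℝ,
    Tendsto (gcDensitySeq U μ) atTop (nhds (1 - δ)) ∧
    ∀ Θ : SymmetricTolerance, ∃ (K : TrigPolyC4v) (Λ : ℝ) (L₀ : ℕ),
      symmetricRegimeCertificateT U (μ - U / 2) (capRgDataSized E₁ (sizeFamily_pos hE)) Θ K Λ L₀

/-- The filed crux implies the successor (take `E₁ = 4`) ONLY after the frame shift is undone: as filed, [2]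
certifies at `μ`, [2′] at `μ - U/2`; the two are NOT comparable by logic alone, which is the point of C′.
What IS pure logic: a filed-shape certificate produced at `μ - U/2` gives [2′] with `E₁ = 4`. -/
theorem sized_of_shifted_filed
    (h : ∃ U ∈ Set.Icc (2:ℝ) 3, ∃ δ ∈ Set.Icc (1/5:ℝ) (7/20), ∃ μ : ℝ,
      Tendsto (gcDensitySeq U μ) atTop (nhds (1 - δ)) ∧
      ∀ Θ : SymmetricTolerance, ∃ (K : TrigPolyC4v) (Λ : ℝ) (L₀ : ℕ),
        symmetricRegimeCertificateT U (μ - U / 2) capRgCornerDataT Θ K Λ L₀) :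
    CapRgSymmetricCertificateSized := by
  obtain ⟨U, hU, δ, hδ, μ, hd, hc⟩ := h
  refine ⟨4, ⟨le_rfl, by norm_num⟩, U, hU, δ, hδ, μ, hd, ?_⟩
  intro Θ
  obtain ⟨K, Λ, L₀, hK⟩ := hc Θ
  exact ⟨K, Λ, L₀, by rw [capRgDataSized_four]; exact hK⟩

/-! ## §3 The consumer re-typed in the same pass, and the glue -/

/-- **[3′] `SeededBrokenRegimeBoseFermiSized`** (sketch): the filed [3] with `∀ E₁ ∈ 𝒮` outermost and the
hypothesis certificate read at `μ - U/2` over `capRgDataSized E₁`; conclusion byte-identical to the filed one. -/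
def SeededBrokenRegimeBoseFermiSized : Prop :=
  ∀ E₁ : ℚ, ∀ hE : E₁ ∈ sizeFamily, ∀ kStar etaStar : ℚ, 0 < kStar → 0 < etaStar →
    ∃ Θ : SymmetricTolerance, ∀ U ∈ Set.Icc (2:ℝ) 3, ∀ δ ∈ Set.Icc (1/5:ℝ) (7/20), ∀ μ : ℝ,
      Tendsto (gcDensitySeq U μ) atTop (nhds (1 - δ)) →
      ∀ (K : TrigPolyC4v) (Λ : ℝ) (L₀ : ℕ),
        symmetricRegimeCertificateT U (μ - U / 2) (capRgDataSized E₁ (sizeFamily_pos hE)) Θ K Λ L₀ →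
        ∃ h₀ : ℝ, 0 < h₀ ∧ ∃ D : HubbardScaleData, D.MeetsThresholds kStar etaStar ∧ 0 < D.numPatches ∧
          0 < D.meanFieldDensity.fst ∧
          ∀ h ∈ Set.Ioc (0:ℝ) h₀, ∃ L₀' : ℕ, D.IsCertifiedEnclosure (hubbardScaleReportCT U μ D h) L₀'

/-- **Glue survives the re-typing**: [2′] → [3′] → R → `FixedPointDWaveOrder`, pure logic (the route's
`closes` step 1 with one more `obtain` for the size). -/
theorem fixedPoint_of_sized (h2 : CapRgSymmetricCertificateSized) (h3 : SeededBrokenRegimeBoseFermiSized)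
    (hR : AposterioriOrderCriterionR) : FixedPointDWaveOrder := by
  obtain ⟨kStar, etaStar, hk, he, hRall⟩ := hR
  obtain ⟨E₁, hE, U, hU, δ, hδ, μ, hdens, hcert⟩ := h2
  obtain ⟨Θ, h3all⟩ := h3 E₁ hE kStar etaStar hk he
  obtain ⟨K, Λ, L₀, hc⟩ := hcert Θ
  obtain ⟨h₀, hh₀, D, hmeets, _hnp, hm₀, hencl⟩ := h3all U hU δ hδ μ hdens K Λ L₀ hc
  have hle := hRall U μ h₀ D hh₀ hencl hmeets
  have hm₀' : (0 : ℝ) < ((D.meanFieldDensity.fst : ℚ) : ℝ) := by exact_mod_cast hm₀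
  refine ⟨U, hU, δ, hδ, μ, hdens, ?_⟩
  rw [Literature.MathematicalPhysics.QuantumLattice.hasDWaveOrder_iff]
  linarith

/-! ## §4 The decomposition Dc1 over the sized record -/

/-- `Sub_D(U; μ₁, μ₂)` — density localisation on an open interval (operator model only; census §7(d): its own
item, dischargeable from one-sided bounds at the two ends by the LANDED `stub_densityOfBracket`, p97590). -/
def DensityLocalisedOn (U μ₁ μ₂ : ℝ) : Prop :=
  ∃ δ ∈ Set.Icc (1/5:ℝ) (7/20), ∃ μ ∈ Set.Ioo μ₁ μ₂, Tendsto (gcDensitySeq U μ) atTop (nhds (1 - δ))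

/-- `Sub_C(U; μ₁, μ₂)` — the sized, frame-shifted certificate at EVERY `μ` of the interval (Grassmann model
only; this leaf still contains the ENGINE and is conjecture-grade at every pinning). -/
def CertificateOnIntervalSized (U μ₁ μ₂ : ℝ) : Prop :=
  ∃ E₁ : ℚ, ∃ hE : E₁ ∈ sizeFamily, ∀ μ ∈ Set.Ioo μ₁ μ₂, ∀ Θ : SymmetricTolerance,
    ∃ (K : TrigPolyC4v) (Λ : ℝ) (L₀ : ℕ),
      symmetricRegimeCertificateT U (μ - U / 2) (capRgDataSized E₁ (sizeFamily_pos hE)) Θ K Λ L₀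

/-- **Dc1 glue**: the two leaves give [2′] by pure logic. -/
theorem sized_of_subs {U μ₁ μ₂ : ℝ} (hU : U ∈ Set.Icc (2:ℝ) 3) (hD : DensityLocalisedOn U μ₁ μ₂)
    (hC : CertificateOnIntervalSized U μ₁ μ₂) : CapRgSymmetricCertificateSized := by
  obtain ⟨δ, hδ, μ, hμ, hd⟩ := hD
  obtain ⟨E₁, hE, hall⟩ := hC
  exact ⟨E₁, hE, U, hU, δ, hδ, μ, hd, fun Θ => hall μ hμ Θ⟩

end Summit.HubbardSuperconductivity.HubbardSuperconductivity.Cruxes.CapRgSymmetricCertificatePinned.SuccessorC6
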